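import Summits.CriticalPhenomena.PercolationContinuityZ3.Theorems.SahiCISSlab

/-!
# The corrected Definition 4 ⇒ CIS, general laws — II: assembly.  THE EQUIVALENCE FOR ALL LAWS

Cell `prim-sahi`, typer (generation 17); `--supports stmt-CriticalPhenomena-4575`.  Theorems only (no definitions, no
named facts, no sorries).

Main result: **`isCISae_iff_isCIScylLE`** — for EVERY probability law on `Q_d` (every `d`), CIS in the a.e.-kernel
sense (`IsCISae`, `SahiCISCoupling.lean`) is EQUIVALENT to the corrected Definition 4 (`IsCIScylLE`,
`SahiCISCylinderLE.lean`: Colangelo–Müller–Scarsini's cylinder inequality for all measurable conditioning sets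
`A, B` with `a ≤ b` pointwise, instead of strictly separated ones).  So replacing strict separation by weak pointwise
comparability repairs Definition 4 / Theorem 4 of the source in every dimension and for every law, and — with
`SahiCISPositivity.lean` — laws satisfying the corrected definition are monotone images of Lebesgue measure, positively
associated and Sahi-positive given `L(d,n)`.

Proof of the hard direction (`aepairMonoKernel_condKernel_of_condIncrLastLE`): a `ν ⊗ ν`-almost every comparable
pair `a ≤ b` has its set of equal coordinates `S` carrying a slab `{x_S = a_S}` of POSITIVE mass (pairs meeting a
null slab are null: `prod_null_slab_eq_zero`), and is strictly ordered off `S`; there are countably many positive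
slabs (`countable_pos_slab`), and on each the slab instance `ae_pair_slab_of_condIncrLastLE` (`SahiCISSlab.lean`)
applies.

References: Colangelo–Müller–Scarsini 2006, Def. 4, Thm. 4 [ColangeloMullerScarsini2006].  Statements are this work.
-/

noncomputable section

namespace Summit.CriticalPhenomena.PercolationContinuityZ3.Theorems.SahiCIS

open MeasureTheory ProbabilityTheory Set Filter Topology Function
open Summit.CriticalPhenomena.PercolationContinuityZ3.Theorems.SahiBoxTP2
open scoped ENNReal unitInterval

variable {d : ℕ}

/-- Only countably many slabs over `S` have positive mass. [folklore] -/
theorem countable_pos_slab (ν : Measure (Fin d → I)) [IsFiniteMeasure ν] (S : Finset (Fin d)) :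
    Set.Countable {u : ↥S → I | 0 < ν (slab S u)} :=
  Measure.countable_meas_level_set_pos₀ (Finset.measurable_restrict S).aemeasurable.nullMeasurable

/-- Pairs agreeing on `S` over a NULL slab are `ν ⊗ ν`-null. [this work] -/
theorem prod_null_slab_eq_zero (ν : Measure (Fin d → I)) [IsFiniteMeasure ν] (S : Finset (Fin d)) :
    ν.prod ν {p : (Fin d → I) × (Fin d → I) | S.restrict p.1 = S.restrict p.2 ∧ ν (slab S (S.restrict p.1)) = 0} = 0 := by
  set r : (Fin d → I) → (↥S → I) := S.restrict with hr
  have hrm : Measurable r := Finset.measurable_restrict S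
  set Z : Set (↥S → I) := {v | ν (slab S v) = 0} with hZ
  have hZm : MeasurableSet Z := by
    have hc := countable_pos_slab ν S
    have hZeq : Z = {u : ↥S → I | 0 < ν (slab S u)}ᶜ := by
      ext v; simp [hZ, not_lt]
    rw [hZeq]; exact hc.measurableSet.compl
  set E : Set ((↥S → I) × (↥S → I)) := Set.diagonal (↥S → I) ∩ Prod.fst ⁻¹' Z with hE
  have hEm : MeasurableSet E := isClosed_diagonal.measurableSet.inter (measurable_fst hZm)
  have hsub : {p : (Fin d → I) × (Fin d → I) | S.restrict p.1 = S.restrict p.2 ∧ ν (slab S (S.restrict p.1)) = 0} ⊆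
      Prod.map r r ⁻¹' E := fun p hp => ⟨hp.1, hp.2⟩
  refine measure_mono_null hsub ?_
  rw [← Measure.map_apply (hrm.prodMap hrm) hEm, ← Measure.map_prod_map ν ν hrm hrm, Measure.prod_apply hEm]
  have hslice : ∀ v : ↥S → I, (ν.map r) (Prod.mk v ⁻¹' E) = 0 := fun v => by
    by_cases hv : v ∈ Z
    · have hset : Prod.mk v ⁻¹' E = {v} := by
        ext w
        simp only [hE, mem_preimage, mem_inter_iff, mem_diagonal_iff, mem_singleton_iff]
        exact ⟨fun h => h.1.symm, fun h => ⟨h.symm, hv⟩⟩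
      rw [hset, Measure.map_apply hrm (measurableSet_singleton v)]
      exact hv
    · have hset : Prod.mk v ⁻¹' E = ∅ := eq_empty_of_forall_notMem fun w hw => hv hw.2
      rw [hset, measure_empty]
  simp only [hslice, lintegral_zero]

/-- **The corrected Definition 4 gives an a.e.-pair stochastically increasing canonical kernel, for every law.**
[this work] -/
theorem aepairMonoKernel_condKernel_of_condIncrLastLE (μ : Measure (Fin (d + 1) → I)) [IsProbabilityMeasure μ]
    (hC : CondIncrLastLE μ) : AEPairMonoKernel (μ.map initLast).fst (μ.map initLast).condKernel := by
  classical
  set ρ := μ.map initLast with hρ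
  set ν := ρ.fst with hν
  -- all slab instances at once
  have hInst : ∀ᵐ p ∂(ν.prod ν), ∀ S : Finset (Fin d), ∀ u ∈ {u : ↥S → I | 0 < ν (slab S u)},
      p.1 ∈ slab S u → p.2 ∈ slab S u → (∀ i ∉ S, p.1 i < p.2 i) →
        ∀ y : I, ρ.condKernel p.2 (Iic y) ≤ ρ.condKernel p.1 (Iic y) := by
    rw [ae_all_iff]; intro S
    rw [ae_ball_iff (countable_pos_slab ν S)]
    intro u _
    exact ae_pair_slab_of_condIncrLastLE μ hC S u
  -- the shared slab of almost every pair has positive mass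
  have hNull : ∀ᵐ p ∂(ν.prod ν), ∀ S : Finset (Fin d), S.restrict p.1 = S.restrict p.2 →
      0 < ν (slab S (S.restrict p.1)) := by
    rw [ae_all_iff]; intro S
    rw [ae_iff]
    refine measure_mono_null (fun p hp => ?_) (prod_null_slab_eq_zero ν S)
    simp only [mem_setOf_eq, not_forall, not_lt, le_zero_iff, exists_prop] at hp
    exact hp
  filter_upwards [hInst, hNull] with p h1 h2 hle y
  set S : Finset (Fin d) := Finset.univ.filter fun i => p.1 i = p.2 i with hS
  have hrS : S.restrict p.1 = S.restrict p.2 := funext fun i => (Finset.mem_filter.1 i.2).2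
  have hpos : 0 < ν (slab S (S.restrict p.1)) := h2 S hrS
  exact h1 S (S.restrict p.1) hpos rfl hrS.symm
    (fun i hi => lt_of_le_of_ne (hle i) fun heq => hi (Finset.mem_filter.2 ⟨Finset.mem_univ i, heq⟩)) y

/-- **One level: the corrected Definition 4 for the last coordinate gives `IsCISae (d+1)`** from `IsCISae d` of the
first `d` coordinates, for EVERY law. [this work] -/
theorem isCISae_succ_of_condIncrLastLE (μ : Measure (Fin (d + 1) → I)) [IsProbabilityMeasure μ]
    (h1 : IsCISae d (μ.map initLast).fst) (hC : CondIncrLastLE μ) : IsCISae (d + 1) μ :=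
  (isCISae_succ_iff_condKernel μ).2 ⟨h1, aepairMonoKernel_condKernel_of_condIncrLastLE μ hC⟩

/-- `IsCISae (d+1) μ ↔ IsCISae d µ^{(d)} ∧ CondIncrLastLE μ`, every law. [this work] -/
theorem isCISae_succ_iff_condIncrLastLE (μ : Measure (Fin (d + 1) → I)) [IsProbabilityMeasure μ] :
    IsCISae (d + 1) μ ↔ IsCISae d (μ.map initLast).fst ∧ CondIncrLastLE μ :=
  ⟨fun h => ⟨h.1, h.condIncrLastLE μ⟩, fun h => isCISae_succ_of_condIncrLastLE μ h.1 h.2⟩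

/-- **THE CORRECTED DEFINITION 4 IS EQUIVALENT TO CIS (a.e.-kernel sense), FOR EVERY LAW ON `Q_d`, EVERY `d`.**
[this work] -/
theorem isCISae_iff_isCIScylLE : ∀ (d : ℕ) (μ : Measure (Fin d → I)) [IsProbabilityMeasure μ],
    IsCISae d μ ↔ IsCIScylLE d μ := by
  intro d
  induction d with
  | zero => intro μ _; exact ⟨fun _ => trivial, fun _ => trivial⟩
  | succ d ih =>
    intro μ _
    refine ⟨IsCISae.isCIScylLE (d + 1) μ, fun h => ?_⟩
    exact isCISae_succ_of_condIncrLastLE μ ((ih _).2 h.1) h.2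

/-- Hence laws satisfying the corrected Definition 4 are monotone images of Lebesgue measure. [this work] -/
theorem IsCIScylLE.exists_monotone_coupling (μ : Measure (Fin d → I)) [IsProbabilityMeasure μ] (h : IsCIScylLE d μ) :
    ∃ G : (Fin d → I) → (Fin d → I), Monotone G ∧ Measurable G ∧ (volume : Measure (Fin d → I)).map G = μ :=
  ((isCISae_iff_isCIScylLE d μ).2 h).exists_monotone_coupling

/-- … positively associated. [this work] -/
theorem IsCIScylLE.isPositivelyAssociated (μ : Measure (Fin d → I)) [IsProbabilityMeasure μ] (h : IsCIScylLE d μ) :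
    Literature.Probability.Percolation.IsPositivelyAssociated μ :=
  ((isCISae_iff_isCIScylLE d μ).2 h).isPositivelyAssociated μ

/-- … and Sahi-positive of order `n` given `L(d,n)` (unconditionally `E₃ ≥ 0` on `[0,1]³` etc., see
`SahiCISPositivity.lean`). [this work] -/
theorem IsCIScylLE.msahiE_nonneg {n : ℕ} (hL : LiebSahiContinuum d n) (μ : Measure (Fin d → I))
    [IsProbabilityMeasure μ] (h : IsCIScylLE d μ) (f : Fin n → (Fin d → I) → ℝ) (hfm : ∀ i, Measurable (f i))
    (hf0 : ∀ i x, 0 ≤ f i x) (hmono : ∀ i, Monotone (f i)) :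
    0 ≤ Literature.Combinatorics.Sahi2008.msahiE μ n f :=
  ((isCISae_iff_isCIScylLE d μ).2 h).msahiE_nonneg hL μ f hfm hf0 hmono

end Summit.CriticalPhenomena.PercolationContinuityZ3.Theorems.SahiCIS

end
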